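import Summits.ValiantsHypothesis.ValiantsHypothesis.Theorems.KPlusLogSqLawTropicalBFourFourOrderTypeLawA44R
import Summits.ValiantsHypothesis.ValiantsHypothesis.Theorems.KPlusLogSqLawTropicalBClassReversal
import Summits.ValiantsHypothesis.ValiantsHypothesis.Theorems.KPlusLogSqLawTropicalBThreeFourOrderTypeLawMirror

/-!
# Route «KPlusLogSqLaw», crux `TropicalB` (stmt-ValiantsHypothesis-19771) — `(4,4)` ORDER-TYPE LAW A44R, MIRROR IMAGE:
# the class-reversal image of `designRowD_four_four_33_A44R` (a second exponent region where the `(4,4)` cell is not counting-tight)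

HONEST FRAMING.  Census-structure helper toward the crux `Summit.ValiantsHypothesis.ValiantsHypothesis.Theses.KPlusLogSqLaw.TropicalB` (item
`stmt-ValiantsHypothesis-19771`, route `KPlusLogSqLaw`; cell `pub-symmetroid`, seat val-sym-trop-p5 g12, 2026-08-28; `--supports … --as helper`).
Corollary of `…FourFourOrderTypeLawA44R` by the class-reversal duality `ClassReversal.designRowD_of_classRev` (reflect `d ↦ D − d ∘ rev`,
`D = d₀+d₁+d₂+d₃`; each facet / slope form `g` becomes `l ↦ −g (3 − l)`).  The reflected region is the order-type cell at the mirror triple point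
`2e₃ − … `: in gap form `f₁ = e₃ − e₂, f₂ = e₃ − e₁, f₃ = e₃` it reads `4f₁ < 2f₃ < 3f₂` with the reflected facets; the reflected core is
`0004 ≺ 0040`-type («all class 2», «three 1 + one 3», «two 0 + two 3» read backwards).  Nothing here bears on `TropicalB` in its window, `WeakLifting`,
the doors, `MatrixDescartes` (stmt-ValiantsHypothesis-18050) or VP ≠ VNP.  [this cell]
-/

set_option linter.dupNamespace false
set_option autoImplicit false

namespace Summit.ValiantsHypothesis.ValiantsHypothesis.Theorems.KPlusLogSqLaw

namespace FourFourCore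

open Summit.ValiantsHypothesis.ValiantsHypothesis.Theorems.MatrixDescartes.Negative
open Finset

/-- **mirror image of `designRowD_four_four_33_A44R`** (class-reversal duality): on the reflected cell the `(4,4)` row is at most `33`. -/
theorem designRowD_four_four_33_A44R_mirror (d : Fin 4 → ℕ) (h1 : 3 * d 2 ≤ 2 * d 1 + d 3) (h2 : 3 * d 1 ≤ 2 * d 0 + d 3)
    (h3 : d 0 + d 3 ≤ 2 * d 2) (h4 : 4 * d 2 < 4 * d 3) (h5 : 2 * d 0 + 2 * d 3 < 4 * d 2) (h6 : 3 * d 1 < 2 * d 0 + d 3)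
    (v ε : Fin 4 → Fin 4 → Fin 4 → ℤ) : DesignRowD d v ε 33 := by
  obtain ⟨r0, r1, r2, r3⟩ := ThreeFourCore.rev_eval d
  refine ClassReversal.designRowD_of_classRev d (d 0 + d 1 + d 2 + d 3) v ε (ThreeFourCore.le_total_exp d) 33
    (designRowD_four_four_33_A44R _ ?_ ?_ ?_ ?_ ?_ ?_ _ _) <;>
    (have := h1; have := h2; have := h3; have := h4; have := h5; have := h6; simp only [r0, r1, r2, r3]; omega)

/-- the instance `(0, 8, 13, 25)` = the reflection of `(0, 12, 17, 25)`. -/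
theorem designRowD_four_four_33_A44R_mirror_example (v ε : Fin 4 → Fin 4 → Fin 4 → ℤ) : DesignRowD ![0, 8, 13, 25] v ε 33 :=
  designRowD_four_four_33_A44R_mirror _ (by decide) (by decide) (by decide) (by decide) (by decide) (by decide) v ε

end FourFourCore

end Summit.ValiantsHypothesis.ValiantsHypothesis.Theorems.KPlusLogSqLaw
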